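import Mathlib
import Summits.Ventures.PercRepro2.Defs
import Summits.Ventures.PercRepro2.Graph
import Summits.Ventures.PercRepro2.HullDefs
import Summits.Ventures.PercRepro2.HullPieceFlip
import Summits.Ventures.PercRepro2.SwSide
import Summits.Ventures.PercRepro2.RigidLemma
import Summits.Ventures.PercRepro2.RigidSide
import Summits.Ventures.PercRepro2.TypedRigidSide

/-!
# The typed rigid side injection (RS) on a PINNED fibre, with the pin flip
(blind cell PercRepro2, night-4 g7, 2026-08-25; proofs/NIGHT4-G7.md §7.1, §8h)

The 2-cut composition asks side 1 for g6's typed (RS) (`TypedRS.exists_typedRigidSide`) on the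
fibre with the virtual edge `e = uv` PINNED — and, when side 2 is swapped, with the pin FLIPPED
(red → blue).  When every pinned edge is incident to the side vertex `c`, this is a corollary of the
existing proof: the colour swap (step 1) flips the pins, the datum of `c` (step 2) contains every
edge at `c` — so «pin colour» is a predicate on the datum, and `card_typed_le_datum` accepts any
such predicate — and the monotonicity step (step 3) keeps it.  `exists_typedRigidSidePinned`: an
injection of `{P red, PB blue, C_R(l) ∈ 𝓤, C_B(l) ∈ 𝓓, c ∈ B_side(l)}` into
`{P blue, PB red, C_R(l) ∈ 𝓤, C_B(l) ∈ 𝓓, c ∈ R_side(l)}` under which every red edge inside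
`C_R(c)` of the source is blue in the image (pins included: a red pin inside `C_R(c)` is flipped
with it).  Census (pinned2.py, shape RS): the transitions R → B, B → R, 0 → 0, RB → RB have
0 failures on all connected graphs `n ≤ 6` (`n = 6`: 0 / 100,563 resp. 0 / 138,568 resp. …).
-/

namespace Summit.Ventures.PercRepro2

namespace TypedRS

open Hull SwSide RigidSide

open scoped Classical

variable {V : Type*} {E : Type*} [Fintype E] [DecidableEq E]

section Pinned

variable {ends : E → Sym2 V}

omit [Fintype E] [DecidableEq E] in
/-- The datum of `c` keeps the colour of every edge at `c`. -/
lemma datum_apply_of_incident (c : V) (ζ : Config E) {e : E} (he : c ∈ ends e) :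
    datum ends c ζ e = ζ e := by
  have ht : e ∈ touches ends (cluster ends (blue ζ) c) :=
    ⟨c, mem_cluster_self _ _ _, Sym2.Mem.other he, (Sym2.other_spec he).symm⟩
  simp [datum, ht]

/-- The pinned typed source: `{P red, PB blue, C_R(l) ∈ 𝓤, C_B(l) ∈ 𝓓, c ∈ B_side(l)}`. -/
noncomputable def srcTP (ends : E → Sym2 V) (l c : V) (P PB : Finset E) (𝓤 𝓓 : Set (Set V)) :
    Finset (Config E) :=
  Finset.univ.filter fun ζ =>
    (∀ e ∈ P, ζ e = true) ∧ (∀ e ∈ PB, ζ e = false) ∧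
      cluster ends ζ l ∈ 𝓤 ∧ cluster ends (blue ζ) l ∈ 𝓓 ∧ c ∈ bside ends ζ l

/-- The pinned typed target with the pins FLIPPED:
`{P blue, PB red, C_R(l) ∈ 𝓤, C_B(l) ∈ 𝓓, c ∈ R_side(l)}`. -/
noncomputable def tgtTP (ends : E → Sym2 V) (l c : V) (P PB : Finset E) (𝓤 𝓓 : Set (Set V)) :
    Finset (Config E) :=
  Finset.univ.filter fun ζ =>
    (∀ e ∈ P, ζ e = false) ∧ (∀ e ∈ PB, ζ e = true) ∧
      cluster ends ζ l ∈ 𝓤 ∧ cluster ends (blue ζ) l ∈ 𝓓 ∧ c ∈ rside ends ζ l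

/-- **The Hall inequality of the pinned typed (RS)** (pins incident to `c`, flipped): for an up-set
`𝓤`, a down-set `𝓓` and an up-set `𝓕` of edge sets,
`#{P red, PB blue, C_R(l) ∈ 𝓤, C_B(l) ∈ 𝓓, c ∈ B_side, red_in(C_R(c)) ∈ 𝓕} ≤
#{P blue, PB red, C_R(l) ∈ 𝓤, C_B(l) ∈ 𝓓, c ∈ R_side, blue ∈ 𝓕}`. -/
theorem card_typedRigidSidePinned_le (l c : V) {P PB : Finset E} (hP : ∀ e ∈ P, c ∈ ends e)
    (hPB : ∀ e ∈ PB, c ∈ ends e) {𝓤 𝓓 : Set (Set V)} (h𝓤 : IsUpperSet 𝓤) (h𝓓 : IsLowerSet 𝓓)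
    (𝓕 : Set (Finset E)) (h𝓕 : IsUpperSet 𝓕) :
    (Finset.univ.filter fun ζ : Config E =>
        (∀ e ∈ P, ζ e = true) ∧ (∀ e ∈ PB, ζ e = false) ∧
          cluster ends ζ l ∈ 𝓤 ∧ cluster ends (blue ζ) l ∈ 𝓓 ∧ c ∈ bside ends ζ l ∧
            redIn ends c ζ ∈ 𝓕).card ≤
      (Finset.univ.filter fun ζ : Config E =>
        (∀ e ∈ P, ζ e = false) ∧ (∀ e ∈ PB, ζ e = true) ∧
          cluster ends ζ l ∈ 𝓤 ∧ cluster ends (blue ζ) l ∈ 𝓓 ∧ c ∈ rside ends ζ l ∧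
            RigidSide.blueF ζ ∈ 𝓕).card := by
  -- the datum predicate: `blue_in(C_B(c)) ∈ 𝓕` and the (flipped) pin colours
  let Pd : Config E → Prop := fun d =>
    blueIn ends c d ∈ 𝓕 ∧ (∀ e ∈ P, d e = false) ∧ (∀ e ∈ PB, d e = true)
  have hpred : ∀ ζ : Config E, Pd (datum ends c ζ) ↔
      (blueIn ends c ζ ∈ 𝓕 ∧ (∀ e ∈ P, ζ e = false) ∧ (∀ e ∈ PB, ζ e = true)) := by
    intro ζ
    simp only [Pd, blueIn_datum]
    constructor
    · rintro ⟨h1, h2, h3⟩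
      exact ⟨h1, fun e he => by rw [← datum_apply_of_incident c ζ (hP e he)]; exact h2 e he,
        fun e he => by rw [← datum_apply_of_incident c ζ (hPB e he)]; exact h3 e he⟩
    · rintro ⟨h1, h2, h3⟩
      exact ⟨h1, fun e he => by rw [datum_apply_of_incident c ζ (hP e he)]; exact h2 e he,
        fun e he => by rw [datum_apply_of_incident c ζ (hPB e he)]; exact h3 e he⟩
  -- step 1: the colour swap (flips the pins)
  have step1 : (Finset.univ.filter fun ζ : Config E =>
        (∀ e ∈ P, ζ e = true) ∧ (∀ e ∈ PB, ζ e = false) ∧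
          cluster ends ζ l ∈ 𝓤 ∧ cluster ends (blue ζ) l ∈ 𝓓 ∧ c ∈ bside ends ζ l ∧
            redIn ends c ζ ∈ 𝓕).card ≤
      (Finset.univ.filter fun ζ : Config E =>
        cluster ends (blue ζ) l ∈ 𝓤 ∧ cluster ends ζ l ∈ 𝓓 ∧ c ∈ rside ends ζ l ∧
          Pd (datum ends c ζ)).card := by
    refine Finset.card_le_card_of_injOn blue ?_ ?_
    · intro ζ hζ
      rw [Finset.mem_coe, Finset.mem_filter] at hζ
      obtain ⟨_, hPr, hPBb, hU, hD, hb, hF⟩ := hζ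
      rw [Finset.mem_coe, Finset.mem_filter, blue_blue, rside_blue, hpred, blueIn_blue]
      refine ⟨Finset.mem_univ _, hU, hD, hb, hF, fun e he => ?_, fun e he => ?_⟩
      · simp [blue_apply, hPr e he]
      · simp [blue_apply, hPBb e he]
    · intro ζ₁ _ ζ₂ _ h12
      have := congrArg blue h12
      simpa only [blue_blue] using this
  -- step 2: the typed one-sided inequality for the datum predicate
  have step2 : (Finset.univ.filter fun ζ : Config E =>
        cluster ends (blue ζ) l ∈ 𝓤 ∧ cluster ends ζ l ∈ 𝓓 ∧ c ∈ rside ends ζ l ∧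
          Pd (datum ends c ζ)).card ≤
      (Finset.univ.filter fun ζ : Config E =>
        cluster ends ζ l ∈ 𝓤 ∧ cluster ends (blue ζ) l ∈ 𝓓 ∧ c ∈ rside ends ζ l ∧
          Pd (datum ends c ζ)).card := by
    have key := card_typed_le_datum (ends := ends) l c h𝓤 h𝓓 Pd
    convert key
  -- step 3: `blue_in(C_B(c)) ⊆ blue`, and the pins are where they should be
  have step3 : (Finset.univ.filter fun ζ : Config E =>
        cluster ends ζ l ∈ 𝓤 ∧ cluster ends (blue ζ) l ∈ 𝓓 ∧ c ∈ rside ends ζ l ∧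
          Pd (datum ends c ζ)).card ≤
      (Finset.univ.filter fun ζ : Config E =>
        (∀ e ∈ P, ζ e = false) ∧ (∀ e ∈ PB, ζ e = true) ∧
          cluster ends ζ l ∈ 𝓤 ∧ cluster ends (blue ζ) l ∈ 𝓓 ∧ c ∈ rside ends ζ l ∧
            RigidSide.blueF ζ ∈ 𝓕).card := by
    apply Finset.card_le_card
    intro ζ hζ
    rw [Finset.mem_filter] at hζ ⊢
    obtain ⟨_, hU, hD, hr, hPd⟩ := hζ
    rw [hpred] at hPd
    obtain ⟨hF, hPb, hPBr⟩ := hPd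
    refine ⟨Finset.mem_univ _, hPb, hPBr, hU, hD, hr, h𝓕 ?_ hF⟩
    intro e he
    rw [mem_blueIn] at he
    rw [RigidSide.mem_blueF]; exact he.2
  exact step1.trans (step2.trans step3)

/-- **The pinned typed rigid side injection** (Hall): for pins incident to `c`, an up-set `𝓤` and
a down-set `𝓓`, an injection `srcTP → tgtTP` (pins flipped) under which every red edge inside the
red cluster of `c` of the source is blue in the image. -/
theorem exists_typedRigidSidePinned (l c : V) {P PB : Finset E} (hP : ∀ e ∈ P, c ∈ ends e)
    (hPB : ∀ e ∈ PB, c ∈ ends e) {𝓤 𝓓 : Set (Set V)} (h𝓤 : IsUpperSet 𝓤) (h𝓓 : IsLowerSet 𝓓) :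
    ∃ f : {ζ // ζ ∈ srcTP ends l c P PB 𝓤 𝓓} → Config E, Function.Injective f ∧
      ∀ x, f x ∈ tgtTP ends l c P PB 𝓤 𝓓 ∧
        ∀ e, e ∈ within ends (cluster ends x.1 c) → x.1 e = true → f x e = false := by
  let t : {ζ // ζ ∈ srcTP ends l c P PB 𝓤 𝓓} → Finset (Config E) := fun x =>
    (tgtTP ends l c P PB 𝓤 𝓓).filter fun η => ∀ e ∈ redIn ends c x.1, η e = false
  have hall : ∀ s : Finset {ζ // ζ ∈ srcTP ends l c P PB 𝓤 𝓓}, s.card ≤ (s.biUnion t).card := by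
    intro s
    obtain ⟨𝓕, h𝓕, h𝓕mem⟩ : ∃ 𝓕 : Set (Finset E), IsUpperSet 𝓕 ∧
        ∀ F, F ∈ 𝓕 ↔ ∃ x ∈ s, redIn ends c x.1 ⊆ F :=
      ⟨{F | ∃ x ∈ s, redIn ends c x.1 ⊆ F}, fun F F' hFF' ⟨x, hx, hxF⟩ => ⟨x, hx, hxF.trans hFF'⟩,
        fun F => Iff.rfl⟩
    have e1 : s.biUnion t = Finset.univ.filter fun ζ : Config E =>
        (∀ e ∈ P, ζ e = false) ∧ (∀ e ∈ PB, ζ e = true) ∧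
          cluster ends ζ l ∈ 𝓤 ∧ cluster ends (blue ζ) l ∈ 𝓓 ∧ c ∈ rside ends ζ l ∧
            RigidSide.blueF ζ ∈ 𝓕 := by
      ext η
      simp only [Finset.mem_biUnion, Finset.mem_filter, t, tgtTP, Finset.mem_univ, true_and, h𝓕mem]
      constructor
      · rintro ⟨x, hx, ⟨h0, h0', h1, h2, h3⟩, hsub⟩
        exact ⟨h0, h0', h1, h2, h3, x, hx, fun e he => RigidSide.mem_blueF.2 (hsub e he)⟩
      · rintro ⟨h0, h0', h1, h2, h3, x, hx, hsub⟩
        exact ⟨x, hx, ⟨h0, h0', h1, h2, h3⟩, fun e he => RigidSide.mem_blueF.1 (hsub he)⟩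
    have e2 : s.card ≤ (Finset.univ.filter fun ζ : Config E =>
        (∀ e ∈ P, ζ e = true) ∧ (∀ e ∈ PB, ζ e = false) ∧
          cluster ends ζ l ∈ 𝓤 ∧ cluster ends (blue ζ) l ∈ 𝓓 ∧ c ∈ bside ends ζ l ∧
            redIn ends c ζ ∈ 𝓕).card := by
      refine Finset.card_le_card_of_injOn (fun x => x.1) ?_ ?_
      · intro x hx
        rw [Finset.mem_coe] at hx
        have hx1 := x.2
        simp only [srcTP, Finset.mem_filter, Finset.mem_univ, true_and] at hx1
        simp only [Finset.mem_coe, Finset.mem_filter, Finset.mem_univ, true_and, h𝓕mem]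
        exact ⟨hx1.1, hx1.2.1, hx1.2.2.1, hx1.2.2.2.1, hx1.2.2.2.2, x, hx, subset_rfl⟩
      · intro x _ y _ hxy
        exact Subtype.ext hxy
    rw [e1]
    exact e2.trans (card_typedRigidSidePinned_le (ends := ends) l c hP hPB h𝓤 h𝓓 𝓕 h𝓕)
  obtain ⟨f, hf, hft⟩ := (Finset.all_card_le_biUnion_card_iff_exists_injective t).1 hall
  refine ⟨f, hf, fun x => ?_⟩
  have := hft x
  simp only [t, Finset.mem_filter] at this
  exact ⟨this.1, fun e he hred => this.2 e ((mem_redIn ends).2 ⟨he, hred⟩)⟩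

end Pinned

end TypedRS

end Summit.Ventures.PercRepro2
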